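import Mathlib
import HarnessLib
import Literature.MathematicalPhysics.QuantumLattice.GaugeGroups
import Literature.LinearAlgebra.Matrix.UnitaryGroupMaximalTorus
import Literature.LinearAlgebra.Matrix.SpecialUnitaryGroupConjugacyClasses
import Summits.Ventures.LatticeQCDFlow.Exactness.SpectralKernelJacobianWeylShapeSU

/-!
# Three basics of the spectral torus, any `n`: the Vandermonde product is symmetric, the torus map of a unimodularity- and determinant-preserving eigenvalue map exists, and phase permutations invert

HONEST FRAMING: exact (Metropolis-corrected) sampling algorithms for lattice gauge theory;
figures of merit are autocorrelation/cost numbers at stated couplings and volumes; no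
continuum-physics claim.

Venture `LatticeQCDFlow` (cell pub-lqcd), topic `Exactness`; FANOUT row 10 (`eng-equiv`, engine
`latflow.equiv` `spectral.py`: `log_haar(x) = log |Δ(e^{ix})|²` is symmetric in the eigen-phases; the
torus map `t ↦ diag(f(t_11, …, t_nn))`; `uncanonicalise ∘ canonicalise = id`).  NEW WORK of the cell,
elementary, shared by the `N = 3` and every-`N` booked-density files.  Nothing is cited as a fact; no
number; no definition.

* `vandermondeProd_perm` — `∏_i ∏_{j≠i} ‖d_{σ i} − d_{σ j}‖ = ∏_i ∏_{j≠i} ‖d_i − d_j‖`;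
* `exists_torusMap_specialUnitary` — an eigenvalue map preserving unimodularity and unit product has a
  torus map `fT t = diag(f(t_11, …, t_nn)) ∈ SΔ(n)`;
* `permDiag_inv_permDiag` — for a family of phase permutations `(P σ t)_ii = t_{σi σi}`: `P σ⁻¹ (P σ t) = t`.
-/

noncomputable section

namespace Summit.Ventures.LatticeQCDFlow.Exactness

open Matrix
open Literature.LinearAlgebra.Matrix

variable {n : Type*} [Fintype n] [DecidableEq n]

/-- **`∏_i ∏_{j≠i} ‖d_{σ i} − d_{σ j}‖ = ∏_i ∏_{j≠i} ‖d_i − d_j‖`** (any `n`). -/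
theorem vandermondeProd_perm (σ : Equiv.Perm n) (d : n → ℂ) :
    (∏ a, ∏ b ∈ Finset.univ.erase a, ‖d (σ a) - d (σ b)‖) = ∏ a, ∏ b ∈ Finset.univ.erase a, ‖d a - d b‖ := by
  have hinner : ∀ a, (∏ b ∈ Finset.univ.erase a, ‖d (σ a) - d (σ b)‖) =
      ∏ b ∈ Finset.univ.erase (σ a), ‖d (σ a) - d b‖ := by
    intro a
    refine Finset.prod_equiv σ (fun b => ?_) (fun b _ => rfl)
    simp only [Finset.mem_erase, Finset.mem_univ, and_true, ne_eq, EmbeddingLike.apply_eq_iff_eq]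
  simp_rw [hinner]
  exact Equiv.prod_comp σ (fun a => ∏ b ∈ Finset.univ.erase a, ‖d a - d b‖)

/-- **The torus map of an eigenvalue map preserving unimodularity and unit product exists**:
`fT t = diag(f(t_11, …, t_nn)) ∈ SΔ(n)`. -/
theorem exists_torusMap_specialUnitary {f : (n → ℂ) → (n → ℂ)}
    (hf1 : ∀ d : n → ℂ, (∀ i, ‖d i‖ = 1) → ∀ i, ‖f d i‖ = 1)
    (hfdet : ∀ d : n → ℂ, (∀ i, ‖d i‖ = 1) → ∏ i, d i = 1 → ∏ i, f d i = 1) :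
    ∃ fT : specialDiagonalTorus n → specialDiagonalTorus n, ∀ t : specialDiagonalTorus n,
      ((fT t : Matrix.specialUnitaryGroup n ℂ) : Matrix n n ℂ) =
        diagonal (f fun i => ((t : Matrix.specialUnitaryGroup n ℂ) : Matrix n n ℂ) i i) := by
  have hmem : ∀ t : specialDiagonalTorus n,
      diagonal (f fun i => ((t : Matrix.specialUnitaryGroup n ℂ) : Matrix n n ℂ) i i) ∈ Matrix.specialUnitaryGroup n ℂ := by
    intro t
    obtain ⟨hd1, hprod⟩ :=
      norm_eq_one_and_prod_eq_one_of_mem_specialDiagonalTorus (coe_specialDiagonalTorus_eq_diagonal t)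
    exact (Literature.MathematicalPhysics.QuantumLattice.diagonal_mem_specialUnitaryGroup_iff _).mpr
      ⟨hf1 _ hd1, hfdet _ hd1 hprod⟩
  exact ⟨fun t => ⟨⟨diagonal (f fun i => ((t : Matrix.specialUnitaryGroup n ℂ) : Matrix n n ℂ) i i), hmem t⟩,
    ⟨_, rfl⟩⟩, fun _ => rfl⟩

/-- Two elements of `SΔ(n)` with the same diagonal entries are equal (restated locally for this file's
`permDiag_inv_permDiag`; see `specialDiagonalTorus_ext`). -/
private theorem specialDiagonalTorus_ext' {t s : specialDiagonalTorus n}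
    (h : ∀ i, ((t : Matrix.specialUnitaryGroup n ℂ) : Matrix n n ℂ) i i =
      ((s : Matrix.specialUnitaryGroup n ℂ) : Matrix n n ℂ) i i) : t = s := by
  apply Subtype.ext
  apply Subtype.ext
  rw [coe_specialDiagonalTorus_eq_diagonal t, coe_specialDiagonalTorus_eq_diagonal s]
  exact congrArg diagonal (funext h)

/-- **`P σ⁻¹ (P σ t) = t`** for a family of phase permutations `(P σ t)_ii = t_{σi σi}`. -/
theorem permDiag_inv_permDiag {P : Equiv.Perm n → specialDiagonalTorus n → specialDiagonalTorus n}
    (hP : ∀ σ t i, (((P σ t : specialDiagonalTorus n) : Matrix.specialUnitaryGroup n ℂ) : Matrix n n ℂ) i i =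
      ((t : Matrix.specialUnitaryGroup n ℂ) : Matrix n n ℂ) (σ i) (σ i))
    (σ : Equiv.Perm n) (t : specialDiagonalTorus n) : P σ⁻¹ (P σ t) = t := by
  refine specialDiagonalTorus_ext' fun i => ?_
  rw [hP, hP, Equiv.Perm.inv_def, Equiv.apply_symm_apply]

end Summit.Ventures.LatticeQCDFlow.Exactness
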